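import Summits.CriticalPhenomena.PercolationContinuityZ3.Theorems.SoloInformedBeamGluing
import Summits.CriticalPhenomena.PercolationContinuityZ3.Theorems.SoloInformedExitGate
import HarnessLib
import HarnessLib.Audit.Tags

/-!
# Benjamini–Kalai's "RSW for plaquettes in cubes", typed, and its exact bearing on `θ(p_c) = 0`
on `ℤ³` (solo seat `solo-CriticalPhenomena-informed`, paper §8.6 (E2)/(E9), referee notes 52(iii), 62)

Citation header.  I. Benjamini, G. Kalai, *Around two theorems and a lemma by Lucio Russo*,
Mathematics and Mechanics of Complex Systems **6** (2018) 69–75, doi:10.2140/memocs.2018.6.69,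
§2, p. 71 — verbatim: "Establishing a high-dimensional version of the RSW lemma is a well-known and
very important open problem. [...] Informally look at the critical p for a full infinite surface and
prove RSW for plaquettes in cubes. That is (for d = 3, say), if the probability of no open path from
top to bottom in an n × n × n box is at least 1/2, then there is no open path from top to bottom in
a cube 2n × 2n × n with probability bounded away from 0 independently of n."

What is reproduced.  Only the STATEMENT of the problem, as a `Prop`: `PlaquetteRSW p` is the
displayed implication for nearest-neighbour bond percolation on `ℤ³` with parameter `p`, the
`n × n × n` box being the vertex box `[0,n]³` crossed along coordinate `0` (`cubeBlocking`), and the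
`2n × 2n × n` box being `[0,n] × [0,2n] × [0,2n]` crossed along its SHORT side, i.e. the closed dual
sheet has to span the `2n × 2n` cross-section — the hard direction for sheets, as the long side is
the hard direction for dual paths in the planar lemma (`flatBoxBlocking`).  Lattice conventions
(`n` versus `n + 1` sites per side) are immaterial to the problem and fixed here by the tree's boxes
`xBox`.  `PlaquetteRSWStrong p` is the same with an arbitrary premise level in place of `1/2`, the
form in which "RSW" is usually meant.  Both are tagged `@[conjecture]`, are OPEN, are not claimed
by the cited authors or by us, and enter the theorems below only as hypotheses.

What is new here (ours, kernel-checked).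
* `vertCrossing_anti_height` — box crossings are ANTITONE IN THE HEIGHT: an open bottom–top
  crossing of `B = [a,b] × [0,t'] × [0,ℓ]^{d-2}` contains, up to its first arrival at level `t ≤ t'`,
  an open bottom–top crossing of the box of height `t` (first-exit decomposition of the walk,
  `exists_exit_of_walk`; one lattice step moves a coordinate by at most one,
  `coord_sub_le_one_of_adj`).  With the lateral monotonicity `vertCrossing_mono` of
  `SoloInformedBeamGluing` this makes blocking probabilities monotone in all three extents.
* `percolationContinuityZ3_of_plaquetteRSW` — **the exact bearing of the Benjamini–Kalai problem on
  the conjunct**: `PlaquetteRSW (p_c(ℤ³))` together with its own premise at `p_c` for infinitely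
  many `n` (the critical cube `[0,n]³` has no open bottom–top crossing with probability `≥ 1/2`)
  implies `PercolationContinuityZ3` (`θ(p_c) = 0` on `ℤ³`).  Proof: the conclusion of the problem
  at scale `n` is a blocked flat box `(2n, n; 2n)`; by the two monotonicities it yields, with
  `u = ⌊n/3⌋` (`6u ≤ 2n`, `4u ≥ n` for `n ≥ 6`), a blocked box `(6u, 4u; 6u)`, which is — up to a
  translation, `real_slabCrossing_four_eq` — the near-cube brick of the cube face with `r = 4`;
  `percolationContinuityZ3_of_slabCrossing_le` (`SoloInformedCubeFace`) closes.
  `percolationContinuityZ3_of_plaquetteRSWStrong` is the same with any premise level `c₁ > 0`.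

Reading (paper §8.6 (E2), (E9)).  The problem as posed is an implication whose PREMISE at
`p = p_c` — a lower bound on the blocking probability of the critical cube — is itself not a
theorem; so a solution of the Benjamini–Kalai problem decides the conjunct only together with that
premise, and the pair (premise, RSW step) has the shape of the pair (seed, extension) of the sheet
calculus of §8: the premise at level `c₁` is WEAKER than the square-beam seed `SquareBeamSeed`
(a blocked cube, aspect `1`, instead of a blocked beam of aspect `1 + 1/q`: lateral monotonicity),
while the RSW step `cube ⇒ (2n, n; 2n)` raises the type `0 → 2` in one stroke where the windowed
reflection step `ReflectionStepFrac` raises `1 → 2` (no formal implication between the two steps is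
claimed).  Nothing here is specific to `p_c` except the last two theorems.
-/

noncomputable section

namespace Summit.CriticalPhenomena.PercolationContinuityZ3.Theorems

open MeasureTheory ProbabilityTheory Filter Topology
open Literature.Probability.Percolation Literature.Probability.LatticeModels
open Literature.Probability.Percolation.CerfDembinVanishing
open scoped ENNReal

namespace SurfaceTension

variable {d : ℕ}

/-! ## Box crossings are antitone in the height -/

/-- **Height monotonicity.** An open bottom–top crossing of the box of height `t'` contains an open
bottom–top crossing of the box of every smaller height `t ≤ t'` with the same base: follow the path
from the bottom until it first reaches level `t`. -/
theorem vertCrossing_anti_height (ℓ : ℕ) {t t' : ℕ} (htt' : t ≤ t') (k₀ k₁ : Fin d) (a b : ℤ) :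
    vertCrossing ℓ t' k₀ k₁ a b ⊆ vertCrossing ℓ t k₀ k₁ a b := by
  classical
  intro ω hω
  rw [vertCrossing, mem_linked_iff] at hω ⊢
  obtain ⟨u, ⟨huB, hu0⟩, v, ⟨hvB, hvt⟩, huv⟩ := hω
  -- the small box and the membership of `u` in it
  have huB' : u ∈ xBox ℓ t k₀ k₁ a b := by
    simp only [xBox, Set.mem_setOf_eq] at huB ⊢
    exact ⟨huB.1, ⟨by rw [hu0], by rw [hu0]; positivity⟩, huB.2.2⟩
  rcases Nat.eq_zero_or_pos t with ht0 | htpos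
  · -- height `0`: the bottom site is on the top face as well
    subst ht0
    refine ⟨u, ⟨huB', hu0⟩, u, ⟨huB', by rw [hu0]; simp⟩, ?_⟩
    rw [inConn_self]; trivial
  -- the walk inside the big box
  rw [mem_inConn_iff] at huv
  obtain ⟨W⟩ := huv
  set H : SimpleGraph (Site d) := openGraph ω ⊓ withinGraph (zdGraph d) (xBox ℓ t' k₀ k₁ a b)
    with hHdef
  have hH : H ≤ zdGraph d := fun x y h => (withinGraph_le _ _) h.2
  -- `R`: the sites of the big box strictly below level `t`
  set R : Set (Site d) := {x | x ∈ xBox ℓ t' k₀ k₁ a b ∧ x k₀ < t} with hRdef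
  have hRsub : R ⊆ xBox ℓ t k₀ k₁ a b := by
    intro x hx
    simp only [hRdef, xBox, Set.mem_setOf_eq] at hx ⊢
    exact ⟨hx.1.1, ⟨hx.1.2.1.1, hx.2.le⟩, hx.1.2.2⟩
  have huR : u ∈ R := ⟨huB, by rw [hu0]; exact_mod_cast htpos⟩
  have hvR : v ∉ R := fun h => by
    have := h.2; rw [hvt] at this; exact absurd (by exact_mod_cast this : t' < t) (not_lt.2 htt')
  obtain ⟨x, y, hxR, hyR, hxy, hux⟩ := exists_exit_of_walk hH R W huR hvR
  -- the exit vertex `y` lies in the big box, at level exactly `t`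
  have hxyH := hxy
  rw [hHdef, SimpleGraph.inf_adj, withinGraph_adj] at hxyH
  obtain ⟨hopen, hzd, -, hyB⟩ := hxyH
  have hy_ge : (t : ℤ) ≤ y k₀ := by
    by_contra h
    exact hyR ⟨hyB, not_le.1 h⟩
  have hy_le : y k₀ ≤ t := by
    have h1 := (coord_sub_le_one_of_adj hzd k₀).2
    have h2 := hxR.2
    omega
  have hyt : y k₀ = t := le_antisymm hy_le hy_ge
  have hyB' : y ∈ xBox ℓ t k₀ k₁ a b := by
    simp only [xBox, Set.mem_setOf_eq] at hyB ⊢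
    exact ⟨hyB.1, ⟨hyB.2.1.1, hy_le⟩, hyB.2.2⟩
  refine ⟨u, ⟨huB', hu0⟩, y, ⟨hyB', hyt⟩, ?_⟩
  rw [mem_inConn_iff]
  -- the walk up to the exit stays in `R ⊆` small box; the exit edge lies in the small box
  have hle : H ⊓ withinGraph (zdGraph d) R ≤
      openGraph ω ⊓ withinGraph (zdGraph d) (xBox ℓ t k₀ k₁ a b) := by
    intro z w h
    rw [SimpleGraph.inf_adj, withinGraph_adj] at h ⊢
    rw [hHdef, SimpleGraph.inf_adj] at h
    exact ⟨h.1.1, h.2.1, hRsub h.2.2.1, hRsub h.2.2.2⟩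
  refine (hux.mono hle).trans (SimpleGraph.Adj.reachable ?_)
  rw [SimpleGraph.inf_adj, withinGraph_adj]
  exact ⟨hopen, hzd, hRsub hxR, hyB'⟩

/-- Blocking probabilities increase with the height. -/
theorem real_vertCrossing_compl_mono_height (p : unitInterval) (ℓ : ℕ) {t t' : ℕ} (htt' : t ≤ t')
    (k₀ k₁ : Fin d) (a b : ℤ) :
    (bondPercolation (zdGraph d) p).real (vertCrossing ℓ t k₀ k₁ a b)ᶜ ≤
      (bondPercolation (zdGraph d) p).real (vertCrossing ℓ t' k₀ k₁ a b)ᶜ :=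
  measureReal_mono (Set.compl_subset_compl.2 (vertCrossing_anti_height ℓ htt' k₀ k₁ a b))

/-! ## The Benjamini–Kalai problem, typed -/

/-- `P_p`(no open bottom–top crossing of the cube `[0,n]³` inside it), vertical direction `0`
("the probability of no open path from top to bottom in an `n × n × n` box", Benjamini–Kalai 2018,
p. 71). -/
def cubeBlocking (p : unitInterval) (n : ℕ) : ℝ :=
  (bondPercolation (zdGraph 3) p).real (vertCrossing n n (0 : Fin 3) 1 0 (n : ℕ))ᶜ

/-- `P_p`(no open bottom–top crossing of the flat box `[0,n] × [0,2n] × [0,2n]` inside it),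
vertical direction `0`, height `n` ("no open path from top to bottom in a cube `2n × 2n × n`",
Benjamini–Kalai 2018, p. 71: the closed dual sheet spans the `2n × 2n` cross-section). -/
def flatBoxBlocking (p : unitInterval) (n : ℕ) : ℝ :=
  (bondPercolation (zdGraph 3) p).real (vertCrossing (2 * n) n (0 : Fin 3) 1 0 (2 * n : ℕ))ᶜ

/-- **Benjamini–Kalai's "RSW for plaquettes in cubes"** (Math. Mech. Complex Syst. 6 (2018), p. 71),
for bond percolation on `ℤ³` at parameter `p`: there is `c > 0` such that for every `n ≥ 1`, if the
cube `[0,n]³` has no open bottom–top crossing with probability at least `1/2`, then the flat box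
`[0,n] × [0,2n]²` has no open bottom–top crossing with probability at least `c`.  OPEN PROBLEM —
stated by the cited authors as a problem, not a result; used here only as a hypothesis. -/
@[conjecture]
def PlaquetteRSW (p : unitInterval) : Prop :=
  ∃ c : ℝ, 0 < c ∧ ∀ n : ℕ, 1 ≤ n → (1 / 2 : ℝ) ≤ cubeBlocking p n → c ≤ flatBoxBlocking p n

/-- The same problem with an arbitrary premise level `c₁ > 0` in place of `1/2` (the usual shape
of an RSW statement: every lower bound for the cube propagates to some lower bound for the flat
box).  OPEN; used only as a hypothesis. -/
@[conjecture]
def PlaquetteRSWStrong (p : unitInterval) : Prop :=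
  ∀ c₁ : ℝ, 0 < c₁ → ∃ c₂ : ℝ, 0 < c₂ ∧ ∀ n : ℕ, 1 ≤ n →
    c₁ ≤ cubeBlocking p n → c₂ ≤ flatBoxBlocking p n

/-! ## From a blocked flat box to the near-cube brick of the cube face -/

/-- A blocked flat box `(2n, n; 2n)` at scale `n ≥ 6` gives, with `u = ⌊n/3⌋ ≥ 1`, a blocked box
`(6u, 4u; 6u)` (shrink the lateral extents, raise the height), i.e. a blocked near-cube brick of
the cube face with `r = 4`. -/
theorem real_slabCrossing_four_le_of_flatBox (p : unitInterval) {n : ℕ} (hn : 6 ≤ n) {c : ℝ}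
    (h : c ≤ flatBoxBlocking p n) :
    (bondPercolation (zdGraph 3) p).real (slabCrossing (n / 3) 4 (0 : Fin 3) 0) ≤ 1 - c := by
  have h01 : (0 : Fin 3) ≠ 1 := by decide
  have h6 : 6 * (n / 3) ≤ 2 * n := by omega
  have h4 : n ≤ 4 * (n / 3) := by omega
  have step₁ : flatBoxBlocking p n ≤ (bondPercolation (zdGraph 3) p).real
      (vertCrossing (2 * n) (4 * (n / 3)) (0 : Fin 3) 1 0 (2 * n : ℕ))ᶜ :=
    real_vertCrossing_compl_mono_height p (2 * n) h4 0 1 0 _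
  have step₂ : (bondPercolation (zdGraph 3) p).real
      (vertCrossing (2 * n) (4 * (n / 3)) (0 : Fin 3) 1 0 (2 * n : ℕ))ᶜ ≤
      (bondPercolation (zdGraph 3) p).real
      (vertCrossing (6 * (n / 3)) (4 * (n / 3)) (0 : Fin 3) 1 0 (6 * (n / 3) : ℕ))ᶜ :=
    real_vertCrossing_compl_anti p h6 _ 0 1 0 (by exact_mod_cast h6)
  rw [real_slabCrossing_four_eq p (n / 3) h01]
  have key := (h.trans step₁).trans step₂
  rw [probReal_compl_eq_one_sub (measurableSet_vertCrossing _ _ _ _ _ _)] at key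
  linarith

/-! ## The bearing on the conjunct -/

/-- **Benjamini–Kalai's plaquette RSW at `p_c`, together with its premise for infinitely many `n`,
implies `θ(p_c) = 0` on `ℤ³`.**  If `PlaquetteRSW (p_c(ℤ³))` holds and the critical cube `[0,n]³`
has no open bottom–top crossing with probability `≥ 1/2` for infinitely many `n`, then
`PercolationContinuityZ3`. -/
theorem percolationContinuityZ3_of_plaquetteRSW (hRSW : PlaquetteRSW (criticalProbI 3))
    (hcube : ∃ᶠ n : ℕ in atTop, (1 / 2 : ℝ) ≤ cubeBlocking (criticalProbI 3) n) :
    PercolationContinuityZ3 := by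
  obtain ⟨c, hc, h⟩ := hRSW
  refine percolationContinuityZ3_of_slabCrossing_le (r := 4) (by norm_num) hc ?_
  rw [frequently_atTop] at hcube ⊢
  intro N
  obtain ⟨n, hnN, hn⟩ := hcube (3 * N + 6)
  exact ⟨n / 3, by omega,
    real_slabCrossing_four_le_of_flatBox (criticalProbI 3) (by omega) (h n (by omega) hn)⟩

/-- The same from the strong form and ANY positive premise level: if `PlaquetteRSWStrong (p_c(ℤ³))`
holds and for some `c₁ > 0` the critical cube `[0,n]³` is blocked with probability `≥ c₁` for
infinitely many `n`, then `θ(p_c) = 0` on `ℤ³`. -/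
theorem percolationContinuityZ3_of_plaquetteRSWStrong (hRSW : PlaquetteRSWStrong (criticalProbI 3))
    {c₁ : ℝ} (hc₁ : 0 < c₁)
    (hcube : ∃ᶠ n : ℕ in atTop, c₁ ≤ cubeBlocking (criticalProbI 3) n) :
    PercolationContinuityZ3 := by
  obtain ⟨c, hc, h⟩ := hRSW c₁ hc₁
  refine percolationContinuityZ3_of_slabCrossing_le (r := 4) (by norm_num) hc ?_
  rw [frequently_atTop] at hcube ⊢
  intro N
  obtain ⟨n, hnN, hn⟩ := hcube (3 * N + 6)
  exact ⟨n / 3, by omega,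
    real_slabCrossing_four_le_of_flatBox (criticalProbI 3) (by omega) (h n (by omega) hn)⟩

end SurfaceTension

end Summit.CriticalPhenomena.PercolationContinuityZ3.Theorems

end
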